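import Summits.QuantumFields.YangMills.Theorems.TemperedCurvatureMoments.Negative.TieLoadBearing
import Summits.QuantumFields.YangMills.Theorems.IsotropyFromPowerCountingTemperedCurvatureMomentsOfBddRenormalisation

/-!
# Sketch (crux-ideate, ideator 2): `TemperedCurvatureMoments` via Markov cube peeling

First lemmas of the idea card `markov-cube-peeling` for crux stmt-QuantumFields-17721 (T).
Everything here is a SIGNATURE over existing declarations (sorried where not proved).
-/

noncomputable section

-- tree-known `Fin 4` instance workaround (cf. TieLoadBearing.lean)
attribute [-instance] SimplexCategory.instFintypeToTypeOrderHomFinHAddNatLenOfNat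

namespace Summit.QuantumFields.YangMills.Cruxes.TemperedCurvatureMoments.MarkovCubePeeling

open scoped BigOperators SchwartzMap
open MeasureTheory Filter Topology
open Literature.MathematicalPhysics.QuantumLattice Literature.MathematicalPhysics.AQFT
  Literature.MathematicalPhysics.QuantumFieldTheory
open Literature.Probability.LatticeModels (box Site)
open Summit.QuantumFields.YangMills.Theorems.NPointIsotropy.Negative (E4)
open Summit.QuantumFields.YangMills.Theorems.OSLegsFromFemtoAndGap (torusMoment)
open Summit.QuantumFields.YangMills.Theorems.CurvatureBoostCovariance.Negative (Tie W1 EightFrameRP PlanarCone)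
open Summit.QuantumFields.YangMills.Theorems.TemperedCurvatureMoments.Negative
  (TemperedApproximants temperedCurvatureMoments_iff)
open Summit.QuantumFields.YangMills.Theses.IsotropyFromPowerCounting (TemperedCurvatureMoments)

/-! ## §1 The abstract peeling identity and bound (pure probability) -/

section Abstract

variable {Ω : Type*} {m0 : MeasurableSpace Ω}

/-- **Peeling identity.** `n` bounded observables `O j`, sub-σ-algebras `𝓕 j` ("links off cube `j`"),
versions `h j` of `μ[O j | 𝓕 j]` that are `𝓕 i`-measurable for `i ≠ j` (Markov: `h j` lives on the
shell of cube `j`, off cube `i`), the other observables and the spectator `g` measurable off each cube: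
`E[g ∏ⱼ c(Oⱼ − m)] = E[g ∏ⱼ c(hⱼ − m)]` (n applications of the tower property). -/
theorem integral_mul_prod_eq_integral_mul_prod_condExp (μ : Measure Ω) [IsProbabilityMeasure μ]
    {n : ℕ} (𝓕 : Fin n → MeasurableSpace Ω) (h𝓕 : ∀ j, 𝓕 j ≤ m0)
    (O h : Fin n → Ω → ℝ) (g : Ω → ℝ) (c m M B : ℝ)
    (hOm : ∀ j, Measurable (O j)) (hOb : ∀ j ω, |O j ω| ≤ M)
    (hgm : Measurable g) (hgb : ∀ ω, |g ω| ≤ B)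
    (hh : ∀ j, h j =ᵐ[μ] μ[O j | 𝓕 j]) (hhj : ∀ j, Measurable[𝓕 j] (h j)) (hhb : ∀ j ω, |h j ω| ≤ M)
    (hhm : ∀ i j, i ≠ j → Measurable[𝓕 j] (h i))
    (hOm' : ∀ i j, i ≠ j → Measurable[𝓕 j] (O i))
    (hgm' : ∀ j, Measurable[𝓕 j] g) :
    ∫ ω, g ω * ∏ j, c * (O j ω - m) ∂μ = ∫ ω, g ω * ∏ j, c * (h j ω - m) ∂μ := by
  sorry

/-- **Peeling bound** (identity + generalised Hölder with `n` factors in `Lⁿ`):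
`|E[g ∏ⱼ c(Oⱼ − m)]| ≤ B ∏ⱼ (|κ| + |c| ‖hⱼ − E Oⱼ‖ₙ)`, `κ = c (E Oⱼ − m)` (common mean). -/
theorem abs_integral_mul_prod_le (μ : Measure Ω) [IsProbabilityMeasure μ]
    {n : ℕ} (hn : 0 < n) (𝓕 : Fin n → MeasurableSpace Ω) (h𝓕 : ∀ j, 𝓕 j ≤ m0)
    (O h : Fin n → Ω → ℝ) (g : Ω → ℝ) (c m M B κ : ℝ)
    (hOm : ∀ j, Measurable (O j)) (hOb : ∀ j ω, |O j ω| ≤ M)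
    (hgm : Measurable g) (hgb : ∀ ω, |g ω| ≤ B)
    (hh : ∀ j, h j =ᵐ[μ] μ[O j | 𝓕 j]) (hhj : ∀ j, Measurable[𝓕 j] (h j)) (hhb : ∀ j ω, |h j ω| ≤ M)
    (hhm : ∀ i j, i ≠ j → Measurable[𝓕 j] (h i))
    (hOm' : ∀ i j, i ≠ j → Measurable[𝓕 j] (O i))
    (hgm' : ∀ j, Measurable[𝓕 j] g)
    (hκ : ∀ j, c * (∫ ω, O j ω ∂μ - m) = κ) :
    |∫ ω, g ω * ∏ j, c * (O j ω - m) ∂μ| ≤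
      B * ∏ j, (|κ| + |c| * (∫ ω, |h j ω - ∫ ω', O j ω' ∂μ| ^ (n : ℝ) ∂μ) ^ (1 / (n : ℝ))) := by
  sorry

end Abstract

/-! ## §2 The renormalised boundary influence of ONE plaquette and the reduction of T -/

variable {G : Type} [Group G] [TopologicalSpace G] [IsTopologicalGroup G] [CompactSpace G]
  [MeasurableSpace G] [BorelSpace G]

/-- Links of the torus of side `2L+1` based in the cube of radius `R` about the origin. -/
def cubeEdges (L R : ℕ) : Set (Edge 4 (2 * L + 1)) :=
  {e | ∀ i : Fin 4, (e.1 i).val ≤ R ∨ 2 * L + 1 - R ≤ (e.1 i).val}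

/-- **`Lᵖ` boundary influence** of the Wilson action density at the origin from the links off the cube of
radius `R`: `ι_p(β, L, R) = ‖E_β[O_0 | links off cube_R] − ⟨O_0⟩_β‖_{Lᵖ(μ_β)}` on the torus of side
`2L+1`. (The `p = ∞` version is the Dobrushin influence coefficient of `O_0`.) -/
def influence (r : LatticeRep G) (β : ℝ) (L R : ℕ) (p : ℝ) : ℝ :=
  (∫ U, |((wilsonMeasure (d := 4) (L := 2 * L + 1) r.ρ β)[fun V =>
          r.curvature.F (torusLift (2 * L + 1) V) |
          cylinderEvents (X := fun _ : Edge 4 (2 * L + 1) => G) (cubeEdges L R)ᶜ]) U -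
        wilsonTorusMean r.ρ β L r.curvature.F| ^ p
      ∂(wilsonMeasure (d := 4) (L := 2 * L + 1) r.ρ β)) ^ (1 / p)

/-- **[BI-Lᵖ] Tempered renormalised influence along the scheme**: beyond a vanishing physical radius
`a_k d_k → 0`, `|c_k| · ι_p(β_k, L_k, R) ≤ C (a_k R)⁻ᴺ` for all cubes fitting in the torus. -/
def TemperedInfluence (r : LatticeRep G) (sch : SpeciesScheme (YMSpecies G)) (p : ℝ) : Prop :=
  ∃ (C : ℝ) (N k₀ : ℕ) (d : ℕ → ℕ), Tendsto (fun k => sch.a k * d k) atTop (𝓝 0) ∧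
    ∀ k, k₀ ≤ k → ∀ R : ℕ, d k ≤ R → 2 * R ≤ sch.L k →
      |sch.c r.curvature k| * influence r (sch.β k) (sch.L k) R p ≤ C * ((sch.a k * R)⁻¹) ^ N

/-- **Pure-analysis reduction (truncation + density).** Uniformly tempered densities whose Riemann sums
converge on the DENSE class of compactly supported, pairwise disjointly supported real tensors already
give `TemperedApproximants` (equicontinuity on `⁰𝒮`-tensors + continuity of `S₁ n`). -/
theorem temperedApproximants_of_separated (a : ℕ → ℝ) (L : ℕ → ℕ) (S₁ : SchwingerFamily E4) (n : ℕ)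
    (D : ℕ → (Fin n → Site 4) → ℝ) (C : ℝ) (N k₀ : ℕ) (hC : 0 < C)
    (hD : ∀ k : ℕ, k₀ ≤ k → ∀ x : Fin n → Site 4, (∀ i, x i ∈ box 4 (L k)) → Function.Injective x →
      |D k x| ≤ C * (1 + ‖fun i => a k • siteToE (x i)‖) ^ N *
        (1 + ∑ i, ∑ j ∈ Finset.univ.erase i, ‖a k • siteToE (x i) - a k • siteToE (x j)‖⁻¹) ^ N)
    (hconv : ∀ (f : Fin n → 𝓢(E4, ℝ)) (F : 𝓢((Fin n → E4), ℂ)),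
      IsTensorOf F (fun i => ofRealTest (f i)) → (∀ i, HasCompactSupport (f i)) →
      (∀ i j, i ≠ j → Disjoint (tsupport (f i)) (tsupport (f j))) →
        Tendsto (fun k => (((a k ^ 4) ^ n *
          ∑ x ∈ Fintype.piFinset (fun _ : Fin n => box 4 (L k)),
            (∏ i, f i (a k • siteToE (x i))) * D k x : ℝ) : ℂ)) atTop (𝓝 (S₁ n F))) :
    TemperedApproximants a L S₁ n := by
  sorry

/-- **Separated-support reduction for the TRUE densities** (idea `separated-support-reduction`): T in degree `n`
from the tie and temperedness of `c_kⁿ · torusMoment` on the INNER half-box at multisites with all pairwise lattice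
(sup-)distances `≥ d_k`, for some radii with `a_k d_k → 0` — strictly weaker than p140303's hypothesis (all injective
multisites), and free of any growth condition on `c_k`. -/
theorem temperedApproximants_of_trueDensity_tempered_beyond (r : LatticeRep G) (sch : SpeciesScheme (YMSpecies G))
    (S₁ : SchwingerFamily E4) (htie : Tie r sch S₁) {n : ℕ} (hn : 0 < n)
    (hD : ∃ (C : ℝ) (N k₀ : ℕ) (d : ℕ → ℕ), Tendsto (fun k => sch.a k * d k) atTop (𝓝 0) ∧
      ∀ k : ℕ, k₀ ≤ k → ∀ x : Fin n → Site 4, (∀ i, x i ∈ box 4 (sch.L k / 2)) →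
        (∀ i j, i ≠ j → ∃ μ : Fin 4, (d k : ℤ) ≤ |x i μ - x j μ|) →
        |(sch.c r.curvature k) ^ n * torusMoment r.ρ (sch.β k) (sch.L k) r.curvature.F (sch.m r.curvature k) x| ≤
          C * (1 + ‖fun i => sch.a k • siteToE (x i)‖) ^ N *
            (1 + ∑ i, ∑ j ∈ Finset.univ.erase i,
              ‖sch.a k • siteToE (x i) - sch.a k • siteToE (x j)‖⁻¹) ^ N) :
    TemperedApproximants sch.a sch.L S₁ n := by
  sorry

/-- **Headline reduction (the line): T in degree `n` at a tied datum from the tempered `Lⁿ` influence.**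
Witness: the TRUE renormalised density `c_kⁿ · torusMoment` on `d_k`-separated multisites of the inner
half-box, zero elsewhere; bound by peeling (`∏ⱼ (|κ_k| + |c_k| ι_n(k, R_j))`, `R_j` = half the distance
to the nearest other point); convergence by the tie on separated compactly supported tensors + density. -/
theorem temperedApproximants_of_temperedInfluence (r : LatticeRep G) (sch : SpeciesScheme (YMSpecies G))
    (S₁ : SchwingerFamily E4) (htie : Tie r sch S₁) {n : ℕ} (hn : 0 < n)
    (hBI : TemperedInfluence r sch n) : TemperedApproximants sch.a sch.L S₁ n := by
  sorry

/-- **Composition to the crux BY NAME**: `[BI-Lⁿ]` for every tied datum and every degree gives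
`TemperedCurvatureMoments` (the other clauses of `W1`, the eight frames and the cone are not used). -/
theorem temperedCurvatureMoments_of_temperedInfluence
    (hBI : ∀ (G : Type) [Group G] [TopologicalSpace G] [IsTopologicalGroup G] [CompactSpace G]
      [MeasurableSpace G] [BorelSpace G], IsCompactSimpleLieGroup G →
      ∀ (r : LatticeRep G) (sch : SpeciesScheme (YMSpecies G)) (S₁ : SchwingerFamily E4),
        W1 r sch S₁ → ∀ n : ℕ, 0 < n → TemperedInfluence r sch n) :
    TemperedCurvatureMoments := by
  rw [temperedCurvatureMoments_iff]
  intro G _ _ _ _ _ _ hG r sch S₁ hW _ _ n hn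
  exact temperedApproximants_of_temperedInfluence r sch S₁ hW.1 hn (hBI G hG r sch S₁ hW n hn)

/-! ## §3 Sanity anchors of the influence (cheap cases) -/

/-- At `β = 0` the links are independent Haar variables, the interior of the cube is independent of its
exterior, and the influence vanishes identically for `R ≥ 1` (whatever `c_k`). -/
theorem influence_eq_zero_of_beta_zero (r : LatticeRep G) (L R : ℕ) (hR : 1 ≤ R) (hRL : 2 * R ≤ L)
    (p : ℝ) (hp : 1 ≤ p) : influence r 0 L R p = 0 := by
  sorry

end Summit.QuantumFields.YangMills.Cruxes.TemperedCurvatureMoments.MarkovCubePeeling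

end
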